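import Summits.ResolutionOfSingularities.ResolutionOfSingularities.Theorems.EquisingularLiftEquisingularLiftNatSpecimenCuspConeAlgebra
import Summits.ResolutionOfSingularities.ResolutionOfSingularities.Theorems.EquisingularLiftEquisingularLiftNatSpecimenWhitneyCubicForms
import Summits.ResolutionOfSingularities.ResolutionOfSingularities.Theorems.EquisingularLiftEquisingularLiftNatSpecimenHypersurfaceChartRings
import HarnessLib

/-!
# [OURS · L1 W4.5(b) · EL♮(3)] NOSE ENGINE CERTIFICATION ‖ K, specimen 2 — the CUSPIDAL CUBIC CONE `x₀x₂² = x₃³`: the form, the integral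
# hypersurface, the chart rings and the transport of the blow-up chart algebra (file 2/3)

Cell `res-hironaka`, slot W4.5(b); crux **EL♮(3)** (stmt-ResolutionOfSingularities-20148); width seat res-L1-w45b-nose-w3, row «NOSE ENGINE CERT ‖ K» of
res-L1-w45b-plan-1's WIDTH TABLE D1′. `--supports stmt-ResolutionOfSingularities-20148 --as helper`; closes nothing. OURS; NOT a statement of any
manuscript; AI-written, weaker than expert review. One `def` (the form), no `sorry`, standard axioms. Pattern and currency: res-D-pv-022's R2 forms layer
`…NatSpecimenWhitneyCubicForms` (p508519), over res-D-pv-013's generic `HypersurfaceSpecimen.exists_chartQuotEquiv`.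

The specimen `H = V₊(F) ⊂ ℙ³_k`, `F = x₀x₂² − x₃³` — the cone with vertex `[0:1:0:0]` over the cuspidal plane cubic, singular along the double line
`Σ = V(x₂, x₃)` (transversal cusps `A₂`, a triple point at the vertex), over an ARBITRARY field `k`:

* `form`, `isHomogeneous_form`, `prime_form` (degree one in `x₀` with relatively prime coefficients `x₂², −x₃³`), `dehomogenize_form_*`
  (`F(x_c := 1)` = `g₀ = y₁² − y₂³`, `g₁ = y₀y₁² − y₂³`, `g₂ = y₀ − y₂³`, `g₃ = y₀y₂² − 1` of `…NatSpecimenCuspConeAlgebra`);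
* `isIntegral_hypersurface` — `V₊(F)` is integral;
* `isRegularRing_chartRing_of_two_le` — the chart rings off `Σ` (`c = 2, 3`) are regular;
* `isRegularRing_blowupAlgebra_tautVec` — the blow-up chart rings `(ChartRing F c)[(x₂/x_c, x₃/x_c)/(x_a/x_c)]` (`c = 0, 1`, `a = 2, 3`) are regular,
  transported from the four strict-transform charts of `…NatSpecimenCuspConeAlgebra` along `ChartRing F c ≅ k[y]/(g_c)`.

References: Hartshorne 1977 I Thm 3.4, II Ex. 2.9, Example 3.2.6; the cited tree files.
-/

set_option linter.dupNamespace false -- mandated namespace `Summit.<Summit>.<Problem>` of this single-conjunct summit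

noncomputable section

open MvPolynomial HomogeneousLocalization
open Literature.AlgebraicGeometry.Resolution
open Literature.AlgebraicGeometry.Motives Literature.AlgebraicGeometry.Motives.SmoothHypersurface
open Literature.AlgebraicGeometry.Motives.ProjectiveSpace

namespace Summit.ResolutionOfSingularities.ResolutionOfSingularities.Cruxes.EquisingularLiftNat.Sections

namespace CuspCone

variable (k : Type) [Field k]

attribute [local instance] MvPolynomial.gradedAlgebra ProjBaseChange.algebraBase

/-! ## The form `F = x₀x₂² − x₃³` -/

/-- **The cuspidal cubic cone form** `F = x₀x₂² − x₃³ ∈ k[x₀, x₁, x₂, x₃]` (vertex `[0:1:0:0]`; double line `V(x₂, x₃)`). [folklore] -/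
def form : MvPolynomial (Fin 4) k := X 0 * X 2 ^ 2 - X 3 ^ 3

/-- `F` is homogeneous of degree `3`. [folklore] -/
theorem isHomogeneous_form : (form k).IsHomogeneous 3 := by
  have h1 : (X 0 * X 2 ^ 2 : MvPolynomial (Fin 4) k).IsHomogeneous 3 := by
    simpa using (isHomogeneous_X k (0 : Fin 4)).mul ((isHomogeneous_X k (2 : Fin 4)).pow 2)
  have h2 : (X 3 ^ 3 : MvPolynomial (Fin 4) k).IsHomogeneous 3 := by
    simpa using (isHomogeneous_X k (3 : Fin 4)).pow 3
  exact h1.sub h2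

/-- In `x₀`-adic form: `F = C(y₁²)·Y + C(−y₂³)` over `k[y₀, y₁, y₂]` (`y = (x₁, x₂, x₃)`). [folklore] -/
theorem finSuccEquiv_form :
    finSuccEquiv k 3 (form k) = Polynomial.C (X 1 ^ 2) * Polynomial.X + Polynomial.C (-(X 2 ^ 3)) := by
  have h2 : finSuccEquiv k 3 (X 2) = Polynomial.C (X 1) := finSuccEquiv_X_succ (j := 1)
  have h3 : finSuccEquiv k 3 (X 3) = Polynomial.C (X 2) := finSuccEquiv_X_succ (j := 2)
  simp only [form, map_sub, map_mul, map_pow, finSuccEquiv_X_zero, h2, h3, map_neg]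
  ring

/-- The coefficients `y₁²` and `−y₂³` are relatively prime in `k[y₀, y₁, y₂]`. [folklore] -/
theorem isRelPrime_coeff₃ : IsRelPrime (X 1 ^ 2 : MvPolynomial (Fin 3) k) (-(X 2 ^ 3)) := by
  intro d hd1 hd2
  have hp : Prime (X 1 : MvPolynomial (Fin 3) k) := X_prime
  obtain ⟨i, hi, hassoc⟩ := (dvd_prime_pow hp 2).mp hd1
  rcases Nat.eq_zero_or_pos i with rfl | hi0
  · rw [pow_zero] at hassoc
    exact hassoc.symm.isUnit isUnit_one
  · exfalso
    have hX1d : (X 1 : MvPolynomial (Fin 3) k) ∣ d := (dvd_pow_self (X 1) hi0.ne').trans hassoc.symm.dvd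
    have h : (X 1 : MvPolynomial (Fin 3) k) ∣ X 2 ^ 3 := (hX1d.trans hd2).trans (neg_dvd.mpr dvd_rfl)
    exact absurd (X_dvd_X.mp (hp.dvd_of_dvd_pow h)) (by decide)

/-- **`F` is prime** (degree one in `x₀` with relatively prime coefficients; Mathlib `Polynomial.irreducible_C_mul_X_add_C`). [folklore] -/
theorem prime_form : Prime (form k) := by
  have hirr : Irreducible (form k) := by
    rw [← MulEquiv.irreducible_iff (finSuccEquiv k 3), finSuccEquiv_form]
    exact Polynomial.irreducible_C_mul_X_add_C (pow_ne_zero 2 (X_ne_zero 1)) (isRelPrime_coeff₃ k)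
  exact UniqueFactorizationMonoid.irreducible_iff_prime.mp hirr

/-- `x₂ ∉ (F)`: evaluate at `(0, 0, 1, 0)` (`F ↦ 0`, `x₂ ↦ 1`). [folklore] -/
theorem X_two_not_mem_span_form : (X 2 : MvPolynomial (Fin 4) k) ∉ Ideal.span {form k} := by
  intro h
  obtain ⟨q, hq⟩ := Ideal.mem_span_singleton'.mp h
  have h := congrArg (MvPolynomial.eval ![(0 : k), 0, 1, 0]) hq
  rw [form] at h
  simp at h

/-! ## The dehomogenized equations -/

/-- `F(x₀ := 1) = g₀ = y₁² − y₂³` (`y = (x₁, x₂, x₃)`). [folklore] -/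
theorem dehomogenize_form_zero : dehomogenize k (0 : Fin 4) (form k) = g₀ k := by
  simp only [form, g₀, map_sub, map_mul, map_pow, dehomogenize_X_self,
    WhitneyCubic.dehomogenize_X_of_eq k 0 2 1 (by decide), WhitneyCubic.dehomogenize_X_of_eq k 0 3 2 (by decide), one_mul]

/-- `F(x₁ := 1) = g₁ = y₀y₁² − y₂³` (`y = (x₀, x₂, x₃)`). [folklore] -/
theorem dehomogenize_form_one : dehomogenize k (1 : Fin 4) (form k) = g₁ k := by
  simp only [form, g₁, map_sub, map_mul, map_pow,
    WhitneyCubic.dehomogenize_X_of_eq k 1 0 0 (by decide), WhitneyCubic.dehomogenize_X_of_eq k 1 2 1 (by decide),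
    WhitneyCubic.dehomogenize_X_of_eq k 1 3 2 (by decide)]

/-- `F(x₂ := 1) = g₂ = y₀ − y₂³` (`y = (x₀, x₁, x₃)`). [folklore] -/
theorem dehomogenize_form_two : dehomogenize k (2 : Fin 4) (form k) = g₂ k := by
  simp only [form, g₂, map_sub, map_mul, map_pow, dehomogenize_X_self,
    WhitneyCubic.dehomogenize_X_of_eq k 2 0 0 (by decide), WhitneyCubic.dehomogenize_X_of_eq k 2 3 2 (by decide), one_pow, mul_one]

/-- `F(x₃ := 1) = g₃ = y₀y₂² − 1` (`y = (x₀, x₁, x₂)`). [folklore] -/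
theorem dehomogenize_form_three : dehomogenize k (3 : Fin 4) (form k) = g₃ k := by
  simp only [form, g₃, map_sub, map_mul, map_pow, dehomogenize_X_self,
    WhitneyCubic.dehomogenize_X_of_eq k 3 0 0 (by decide), WhitneyCubic.dehomogenize_X_of_eq k 3 2 2 (by decide), one_pow]

/-! ## The hypersurface `H = V₊(F)` is integral -/

/-- `H = V₊(F)` (reduced induced structure) is reduced. [folklore] -/
theorem isReduced_hypersurface : AlgebraicGeometry.IsReduced (hypersurface (form k)).left :=
  Literature.AlgebraicGeometry.Resolution.ComponentGluing.isReduced_subscheme_vanishingIdeal (zeroLocusClosed (form k))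

/-- **`H = V₊(F)` is an integral scheme** (`F` prime ⇒ `V₊(F)` irreducible; reduced by construction). [folklore] -/
theorem isIntegral_hypersurface : AlgebraicGeometry.IsIntegral (hypersurface (form k)).left := by
  haveI := isReduced_hypersurface k
  have hirr : IsIrreducible (Set.range (hypersurfaceι (form k)).left) := by
    rw [range_hypersurfaceι]
    exact isIrreducible_zeroLocus_of_prime _ (isHomogeneous_form k) (prime_form k)
  haveI : IrreducibleSpace (Set.range (hypersurfaceι (form k)).left) := Subtype.irreducibleSpace hirr
  haveI : IrreducibleSpace (hypersurface (form k)).left :=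
    (hypersurfaceι (form k)).left.isClosedEmbedding.isEmbedding.toHomeomorph.irreducibleSpace_iff.mpr this
  exact AlgebraicGeometry.isIntegral_of_irreducibleSpace_of_isReduced _

/-! ## The chart rings `ChartRing F c ≅ k[y]/(g_c)` and the transport of regularity -/

/-- **The chart rings off the double line are regular**: `ChartRing F 2 ≅ k[y]/(g₂)` and `ChartRing F 3 ≅ k[y]/(g₃)`. [folklore] -/
theorem isRegularRing_chartRing_of_two_le (c : Fin 4) (hc : 2 ≤ (c : ℕ)) :
    IsRegularRing (ChartRing (form k) c (isHomogeneous_form k)) := by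
  have hc' : c = 2 ∨ c = 3 := by
    fin_cases c <;> simp at hc ⊢
  rcases hc' with rfl | rfl
  · obtain ⟨θ, -⟩ := HypersurfaceSpecimen.exists_chartQuotEquiv (form k) (isHomogeneous_form k) 2 (g₂ k)
      (dehomogenize_form_two k) (radical_span_g₂ k)
    haveI := isRegularRing_quotient_g₂ k
    exact IsRegularRing.of_ringEquiv θ.symm
  · obtain ⟨θ, -⟩ := HypersurfaceSpecimen.exists_chartQuotEquiv (form k) (isHomogeneous_form k) 3 (g₃ k)
      (dehomogenize_form_three k) (radical_span_g₃ k)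
    haveI := isRegularRing_quotient_g₃ k
    exact IsRegularRing.of_ringEquiv θ.symm

/-- `X '' {1, 2} = {y₁, y₂}`. [folklore] -/
theorem image_X_cenVars : (X '' cenVars : Set (MvPolynomial (Fin 3) k)) = {X 1, X 2} := by
  rw [show (cenVars : Set (Fin 3)) = {1, 2} from rfl, Set.image_pair]

/-- **The blow-up chart rings over `ChartRing F c` (`c = 0, 1`) are regular**, transported from `…NatSpecimenCuspConeAlgebra` along
`ChartRing F c ≅ k[y]/(g_c)`: for the centre `(x₂/x_c, x₃/x_c)` of the double line and `b = x_a/x_c` with `a = c.succAbove i₀` (`i₀ = 1, 2`), the affine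
blowup algebra `(ChartRing F c)[I/b]` is regular whenever `(k[y]/(g_c))[(ȳ₁, ȳ₂)/ȳ_{i₀}]` is. [folklore] -/
theorem isRegularRing_blowupAlgebra_tautVec (c : Fin 4) (f : MvPolynomial (Fin 3) k) (hf : dehomogenize k c (form k) = f)
    (hrad : (Ideal.span {f}).radical = Ideal.span {f}) (hc2 : (2 : Fin 4) = c.succAbove 1) (hc3 : (3 : Fin 4) = c.succAbove 2)
    (i₀ : Fin 3) (a : Fin 4) (ha : a = c.succAbove i₀)
    (hreg : IsRegularRing (blowupAlgebra ((Ideal.span (X '' cenVars)).map (Ideal.Quotient.mk (Ideal.span {f})))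
      (Ideal.Quotient.mk (Ideal.span {f}) (X i₀ : MvPolynomial (Fin 3) k)))) :
    IsRegularRing (blowupAlgebra
      (Ideal.span {tautVec (form k) c (isHomogeneous_form k) 2, tautVec (form k) c (isHomogeneous_form k) 3})
      (tautVec (form k) c (isHomogeneous_form k) a)) := by
  obtain ⟨θ, hθ⟩ := HypersurfaceSpecimen.exists_chartQuotEquiv (form k) (isHomogeneous_form k) c f hf hrad
  have h2 : θ (tautVec (form k) c (isHomogeneous_form k) 2) = Ideal.Quotient.mk _ (X 1) := by
    rw [hc2]; exact hθ 1
  have h3 : θ (tautVec (form k) c (isHomogeneous_form k) 3) = Ideal.Quotient.mk _ (X 2) := by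
    rw [hc3]; exact hθ 2
  have hb : θ (tautVec (form k) c (isHomogeneous_form k) a) = Ideal.Quotient.mk (Ideal.span {f}) (X i₀) := by
    rw [ha]; exact hθ i₀
  have hI : (Ideal.span {tautVec (form k) c (isHomogeneous_form k) 2, tautVec (form k) c (isHomogeneous_form k) 3}).map
      θ.toRingHom = (Ideal.span (X '' cenVars)).map (Ideal.Quotient.mk (Ideal.span {f})) := by
    rw [Ideal.map_span, Set.image_pair, Ideal.map_span, image_X_cenVars, Set.image_pair]
    exact congrArg₂ (fun u v => Ideal.span {u, v}) h2 h3
  refine WhitneyCubic.isRegularRing_blowupAlgebra_of_ringEquiv θ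
    (Ideal.span {tautVec (form k) c (isHomogeneous_form k) 2, tautVec (form k) c (isHomogeneous_form k) 3})
    (tautVec (form k) c (isHomogeneous_form k) a) ?_
  rw [hI, hb]
  exact hreg

/-- **The blow-up chart rings at the generators are regular** (`c = 0, 1`; `a = 2, 3`), fed by the four strict-transform charts of
`…NatSpecimenCuspConeAlgebra`. [folklore] -/
theorem isRegularRing_blowupAlgebra_gen (c : Fin 4) (hc : (c : ℕ) < 2) (a : Fin 4) (ha : 2 ≤ (a : ℕ)) :
    IsRegularRing (blowupAlgebra
      (Ideal.span {tautVec (form k) c (isHomogeneous_form k) 2, tautVec (form k) c (isHomogeneous_form k) 3})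
      (tautVec (form k) c (isHomogeneous_form k) a)) := by
  have hc' : c = 0 ∨ c = 1 := by fin_cases c <;> simp at hc ⊢
  have ha' : a = 2 ∨ a = 3 := by fin_cases a <;> simp at ha ⊢
  rcases hc' with rfl | rfl
  · rcases ha' with rfl | rfl
    · exact isRegularRing_blowupAlgebra_tautVec k 0 (g₀ k) (dehomogenize_form_zero k) (radical_span_g₀ k)
        (by decide) (by decide) 1 2 (by decide) (isRegularRing_chart₀₁ k)
    · exact isRegularRing_blowupAlgebra_tautVec k 0 (g₀ k) (dehomogenize_form_zero k) (radical_span_g₀ k)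
        (by decide) (by decide) 2 3 (by decide) (isRegularRing_chart₀₂ k)
  · rcases ha' with rfl | rfl
    · exact isRegularRing_blowupAlgebra_tautVec k 1 (g₁ k) (dehomogenize_form_one k) (radical_span_g₁ k)
        (by decide) (by decide) 1 2 (by decide) (isRegularRing_chart₁₁ k)
    · exact isRegularRing_blowupAlgebra_tautVec k 1 (g₁ k) (dehomogenize_form_one k) (radical_span_g₁ k)
        (by decide) (by decide) 2 3 (by decide) (isRegularRing_chart₁₂ k)

end CuspCone

end Summit.ResolutionOfSingularities.ResolutionOfSingularities.Cruxes.EquisingularLiftNat.Sections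

end
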